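import Summits.AtomisticToContinuum.BoseEinsteinCondensation.Theorems.BECRewardDescentRewardChordBoundReduction
import Summits.AtomisticToContinuum.BoseEinsteinCondensation.Theorems.BECRewardDescentRewardChordBoundSimpleNonintegrable
import HarnessLib

/-!
# `WalkGlue` (stmt-AtomisticToContinuum-12880) — candidate proof (evidence, prepared by the line lead of crux 12876)

`WalkGlue := RewardScaleChord → SectorGap → CondensateVariance → RewardChordBound` follows from the landed reduction
`rewardChordBound_of_sectorGap_of_condensateVariance_of_nonintegrableSimple` (p157205) and the landed hard-core
Perron–Frobenius kernel `stub_rewardedSimpleNonintegrable` (line `registered` of crux `RewardChordBound`).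
-/

namespace Summit.AtomisticToContinuum.BoseEinsteinCondensation.Theorems

/-- `WalkGlue` holds: the walk's glue is the landed reduction fed with the hard-core kernel (the first hypothesis,
`RewardScaleChord`, is not even needed). [cite: ReedSimonIV1978, Thm XIII.44] -/
theorem walkGlue_proof : Summit.AtomisticToContinuum.BoseEinsteinCondensation.Theses.BECRewardDescent.WalkGlue :=
  fun _ hG hV =>
    Summit.AtomisticToContinuum.BoseEinsteinCondensation.Cruxes.RewardChordBound.Birth.rewardChordBound_of_sectorGap_of_condensateVariance_of_nonintegrableSimple
      hG hV Summit.AtomisticToContinuum.BoseEinsteinCondensation.Cruxes.RewardChordBound.Birth.stub_rewardedSimpleNonintegrable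

end Summit.AtomisticToContinuum.BoseEinsteinCondensation.Theorems
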